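import Summits.HodgeConjecture.HodgeConjecture.Theorems.SecondaryPeriodsRiemannWeightOne

/-!
# Route `SecondaryPeriods`: the assembly item `Assembly` (stmt-HodgeConjecture-16342), PROVED

The frame item of the refutation route `SecondaryPeriods` is
`Assembly : ConiveauOneFailure → ¬ HodgeConjecture` ("it suffices to refute GHC(3,1) for smooth
projective threefolds"). The route's deciding theorem
`Theses.SecondaryPeriods.closes (hRiemann : RiemannWeightOne) (hFail : ConiveauOneFailure) :
¬ HodgeConjecture` proves Grothendieck's observation HC ⟹ GHC(3,1) inline, modulo the route's
crux #6 `RiemannWeightOne` (Riemann's theorem on weight-one Hodge structures, geometric form).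
That crux was PROVED (`riemannWeightOne_proof`, `Theorems/SecondaryPeriodsRiemannWeightOne`,
stmt-HodgeConjecture-16406), so the assembly item now holds outright: `assembly_holds`.

## References

* [GrothendieckTopology1969] A. Grothendieck, Hodge's general conjecture is false for trivial
  reasons, Topology 8 (1969) 299–303, p. 301.
* [Deligne2000] P. Deligne, The Hodge conjecture, Clay problem description (2000), §1.
-/

noncomputable section

set_option linter.dupNamespace false

namespace Summit.HodgeConjecture.HodgeConjecture.Theorems

/-- **Assembly item of route `SecondaryPeriods` (stmt-HodgeConjecture-16342), PROVED**: a smooth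
projective threefold carrying a rational level-one sub-Hodge structure of `H³` not supported on a
divisor refutes the Hodge conjecture — the route's deciding theorem `closes` (Grothendieck's
observation HC ⟹ GHC(3,1), by Riemann + HC on `Y × X` + the Gysin support calculus, then modus
tollens) fed with the proved crux `riemannWeightOne_proof`.
[cite: GrothendieckTopology1969, p. 301] [cite: Deligne2000, §1] -/
theorem assembly_holds : Theses.SecondaryPeriods.Assembly :=
  Theses.SecondaryPeriods.closes riemannWeightOne_proof

end Summit.HodgeConjecture.HodgeConjecture.Theorems

end
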